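/-
Copyright (c) 2026 the pub-hodgecm-mathlib formalisation cell (harness21).  Prover seat hodgecm-mathlib-K2E4-p23 (g2), Track B ∕ K2-LIT, h413 =
`stmt-HodgeConjecture-24833`, ENGINE E1, 5Res campaign, deal (113)∕hmc of K2E1-plan (g6), continued by K2E1-plan (g7) (126) «(113)(iii) =, then hmc second half»:
hmc SECOND HALF, part 1 — THE AVERAGING TRICK (analysis-free, every adelic group datum).
-/
import Literature.NumberTheory.Automorphic.AutomorphicSpectrum     -- ★ `AdelicGroupData.rightRegular`, `rightRegular_apply_coeFn`, `L2`
import Mathlib.MeasureTheory.Integral.Prod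
import Mathlib.MeasureTheory.Function.L2Space
import Mathlib.MeasureTheory.Integral.IntervalIntegral.Basic
import Mathlib.Analysis.SpecialFunctions.Exp
import HarnessLib

/-!
# K2·E1 — `K2E1ArchTorusMatrixCoeffFromCircleAverage`: A CIRCLE-AVERAGE EIGEN-IDENTITY FOR A FUNCTION ON THE AUTOMORPHIC QUOTIENT GIVES THE MATRIX COEFFICIENT
# `⟪R(t)ψ, ψ⟫ = Φ(a)·‖ψ‖²` OF THE RIGHT REGULAR REPRESENTATION (hmc second half, part 1: the averaging trick)

Track B ∕ K2-LIT, crux h413 = `stmt-HodgeConjecture-24833`, route of record `HCCMUnconditional`; cell `hodgecm-mathlib`, squad K2, ENGINE E1 (5Res campaign, ARCH-UNITARITY leg).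
Prover seat `hodgecm-mathlib-K2E4-p23` (g2).  THEOREMS ONLY (no `def`, no `instance`, no notation, no named-fact hypothesis, no `sorry`); lane `--supports stmt-HodgeConjecture-24833
--as helper` (count-neutral).  CLOSES NO SOCKET.

SETTING (★ `AutomorphicSpectrum` conventions): `𝒢` ANY adelic group datum over a number field `K`, `X = 𝒢.automorphicQuotient = G(𝔸)∕(A_G G(K))` (LEFT cosets, left action),
`μ` a `G(𝔸)`-invariant finite measure on `X`, `L2 = Lp ℂ 2 μ`, `R = 𝒢.rightRegular μ` with `(R g ψ)(x) = ψ(g⁻¹ • x)` a.e. (★ `rightRegular_apply_coeFn`); Mathlib's inner product on `L²` is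
conjugate-linear in the FIRST slot (`⟪f, g⟫ = ∫ conj f · g`).

THE THEOREM (`inner_rightRegular_eq_of_circleAverage`).  Let `Ψ : X → ℂ` be measurable and square-integrable, `ψ := Ψ` in `L²`; `k : ℝ → G(𝔸)` continuous (the circle `θ ↦ k_w(θ)`),
`t ∈ G(𝔸)` (the torus element), `q ∈ ℤ`, `Φa ∈ ℂ`, with the two letters
* (KΨ) `Ψ((k θ)⁻¹ • x) = e^{iqθ}·Ψ(x)` for all `x`, `θ` (right `K_w`-type along the circle, in `X`-language), and
* (AV) `(2π)⁻¹ ∫₀^{2π} e^{−iqθ}·Ψ((t·(k θ)⁻¹) • x) dθ = Φa·Ψ(x)` for all `x` (the circle-average eigen-identity — for the E1 consumer: the residue of ★ (113)(iii)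
  `circleAverage_torusAt_eisensteinSeriesU_eq_archTorusCoeff_mul` continued in `z`, read through the dictionary `F(y·g) ↔ Ψ(g⁻¹ • x)`, `y = x̃⁻¹`).
THEN **`⟪R(t)ψ, ψ⟫ = Φa·‖ψ‖²`** — the letter `hmc` of ★ F3∕F2b `arch_unitarity_of_rightRegular_matrixCoeff` at the torus element `t = t_w(a)`.
PROOF (the averaging trick).  `⟪R(t)ψ, ψ⟫ = ∫ conj Ψ(t⁻¹•x)·Ψ(x) dμ = ∫ conj Ψ(x)·Ψ(t•x) dμ =: C` (invariance of `μ` under `t`); for every `θ`, invariance under `(kθ)⁻¹` and (KΨ) give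
`C = e^{−iqθ} ∫ conj Ψ(x)·Ψ((t(kθ)⁻¹)•x) dμ` (§1); integrate `θ` over `(0, 2π]` and swap (Fubini on `(0,2π] × X`; the integrand is dominated by `|Ψ(x)|² + |Ψ((t(kθ)⁻¹)•x)|²`, integrable on the
product because the shear `(θ, x) ↦ (θ, (t(kθ)⁻¹)•x)` preserves `dθ ⊗ μ` — Mathlib `MeasurePreserving.skew_product`, §2): `2π·C = ∫ conj Ψ(x)·(2π·Φa·Ψ(x)) dμ = 2π·Φa·‖ψ‖²` by (AV) (§3).
HONEST LABEL: HC_CM is proved only modulo the 7 printed citations (2 remaining named inputs: hLiu418 = `stmt-HodgeConjecture-24832`, h413 = `stmt-HodgeConjecture-24833`) until rung 0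
closes; this file asserts no named fact and closes no socket; count-neutral.  Part 2 (the residue transfer producing (AV) for the residual form) is a separate file.

## References
* [Folland1995] G. B. Folland, *A Course in Abstract Harmonic Analysis* (1995), §3.1, §3.3 (matrix coefficients of unitary representations).
* [MoeglinWaldspurger1995] C. Mœglin, J.-L. Waldspurger, *Spectral decomposition and Eisenstein series* (1995), IV.3, V.3.13.
* [Knapp1986] A. W. Knapp, *Representation Theory of Semisimple Groups* (1986), VII §1 (`K`-isotypic matrix coefficients as circle averages).
-/

set_option autoImplicit false
-- the mandated namespace repeats the single-problem summit's segment (`HodgeConjecture.HodgeConjecture`)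
set_option linter.dupNamespace false

noncomputable section

open MeasureTheory Set
open scoped ComplexConjugate Real InnerProductSpace
open Literature.NumberTheory.Automorphic

namespace Summit.HodgeConjecture.HodgeConjecture.Cruxes.H413.K2E1ArchTorusMatrixCoeffFromCircleAverage

universe u

variable {K : Type} [Field K] [NumberField K] (𝒢 : AdelicGroupData.{u} K)
  (μ : Measure 𝒢.automorphicQuotient) [SMulInvariantMeasure 𝒢.Adelic 𝒢.automorphicQuotient μ]

/-! ## §0 Scalars -/

/-- `conj (e^{iqθ}) = e^{−iqθ}` for `q ∈ ℤ`, `θ ∈ ℝ`. [folklore] -/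
theorem conj_cexp_int_mul (q : ℤ) (θ : ℝ) : conj (Complex.exp ((q : ℂ) * θ * Complex.I)) = Complex.exp (-((q : ℂ) * θ * Complex.I)) := by
  rw [← Complex.exp_conj, map_mul, map_mul, map_intCast, Complex.conj_ofReal, Complex.conj_I]
  ring_nf

/-- `‖e^{−iqθ}‖ = 1`. [folklore] -/
theorem norm_cexp_neg_int_mul (q : ℤ) (θ : ℝ) : ‖Complex.exp (-((q : ℂ) * θ * Complex.I))‖ = 1 := by
  rw [show -((q : ℂ) * θ * Complex.I) = ((-(q * θ) : ℝ) : ℂ) * Complex.I by push_cast; ring, Complex.norm_exp_ofReal_mul_I]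

/-! ## §1 The slice identity: `∫ conj Ψ · Ψ(t•·) = e^{−iqθ} ∫ conj Ψ · Ψ((t(kθ)⁻¹)•·)` -/

/-- **SLICE IDENTITY.**  For every `θ`: `∫ conj Ψ(x)·Ψ(t•x) dμ = e^{−iqθ}·∫ conj Ψ(x)·Ψ((t·(kθ)⁻¹)•x) dμ` (invariance of `μ` under `(kθ)⁻¹` and the letter (KΨ)). [cite: Folland1995, §3.1] -/
theorem integral_conj_mul_translate_eq (Ψ : 𝒢.automorphicQuotient → ℂ) (q : ℤ) (t : 𝒢.Adelic) (k : ℝ → 𝒢.Adelic)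
    (hKΨ : ∀ (x : 𝒢.automorphicQuotient) (θ : ℝ), Ψ ((k θ)⁻¹ • x) = Complex.exp ((q : ℂ) * θ * Complex.I) * Ψ x) (θ : ℝ) :
    ∫ x, conj (Ψ x) * Ψ (t • x) ∂μ = Complex.exp (-((q : ℂ) * θ * Complex.I)) * ∫ x, conj (Ψ x) * Ψ ((t * (k θ)⁻¹) • x) ∂μ := by
  rw [← integral_smul_eq_self (μ := μ) (fun x => conj (Ψ x) * Ψ (t • x)) (g := (k θ)⁻¹), ← integral_const_mul]
  refine integral_congr_ae (Filter.Eventually.of_forall fun x => ?_)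
  simp only
  rw [hKΨ, map_mul, conj_cexp_int_mul, mul_smul]
  ring

/-! ## §2 Joint measurability and integrability on `(0, 2π] × X` -/

section Product

variable [IsFiniteMeasure μ]

/-- The shear `(θ, x) ↦ (t·(kθ)⁻¹) • x` is jointly measurable (`k` continuous, the action jointly continuous). [folklore] -/
theorem measurable_shear (t : 𝒢.Adelic) {k : ℝ → 𝒢.Adelic} (hk : Continuous k) :
    Measurable fun p : ℝ × 𝒢.automorphicQuotient => (t * (k p.1)⁻¹) • p.2 :=
  ((continuous_const.mul ((hk.comp continuous_fst).inv)).smul continuous_snd).measurable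

/-- The shear `(θ, x) ↦ (θ, (t·(kθ)⁻¹) • x)` preserves `ν ⊗ μ` for every s-finite `ν` on `ℝ` (Mathlib `MeasurePreserving.skew_product`, `μ` invariant). [folklore] -/
theorem measurePreserving_shear (ν : Measure ℝ) [SFinite ν] (t : 𝒢.Adelic) {k : ℝ → 𝒢.Adelic} (hk : Continuous k) :
    MeasurePreserving (fun p : ℝ × 𝒢.automorphicQuotient => (p.1, (t * (k p.1)⁻¹) • p.2)) (ν.prod μ) (ν.prod μ) :=
  (MeasurePreserving.id ν).skew_product (g := fun θ x => (t * (k θ)⁻¹) • x) (measurable_shear 𝒢 t hk)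
    (Filter.Eventually.of_forall fun θ => MeasureTheory.map_smul (t * (k θ)⁻¹) μ)

/-- **INTEGRABILITY OF THE AVERAGING INTEGRAND ON `(0,2π] × X`**: `(θ, x) ↦ conj Ψ(x)·(e^{−iqθ}·Ψ((t(kθ)⁻¹)•x))` is integrable for `dθ|_(0,2π] ⊗ μ` when `Ψ ∈ L²(μ)` is measurable —
dominated by `|Ψ(x)|² + |Ψ((t(kθ)⁻¹)•x)|²`, the second summand integrable by the measure-preserving shear. [cite: Folland1995, §3.3] -/
theorem integrable_averagingIntegrand {Ψ : 𝒢.automorphicQuotient → ℂ} (hΨm : Measurable Ψ) (hΨ2 : MemLp Ψ 2 μ) (q : ℤ) (t : 𝒢.Adelic)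
    {k : ℝ → 𝒢.Adelic} (hk : Continuous k) :
    Integrable (fun p : ℝ × 𝒢.automorphicQuotient => conj (Ψ p.2) * (Complex.exp (-((q : ℂ) * p.1 * Complex.I)) * Ψ ((t * (k p.1)⁻¹) • p.2)))
      ((volume.restrict (Ioc (0 : ℝ) (2 * π))).prod μ) := by
  set ν : Measure ℝ := volume.restrict (Ioc (0 : ℝ) (2 * π)) with hν
  haveI : IsFiniteMeasure ν := by rw [hν]; infer_instance
  have hS := measurable_shear 𝒢 t hk
  have hsq : Integrable (fun x => ‖Ψ x‖ ^ 2) μ := (memLp_two_iff_integrable_sq_norm hΨ2.1).1 hΨ2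
  -- the two dominating summands
  have hB₁ : Integrable (fun p : ℝ × 𝒢.automorphicQuotient => ‖Ψ p.2‖ ^ 2) (ν.prod μ) := by
    simpa only [one_mul] using (integrable_const (1 : ℝ)).mul_prod hsq
  have hB₂ : Integrable (fun p : ℝ × 𝒢.automorphicQuotient => ‖Ψ ((t * (k p.1)⁻¹) • p.2)‖ ^ 2) (ν.prod μ) :=
    ((measurePreserving_shear 𝒢 μ ν t hk).integrable_comp hB₁.aestronglyMeasurable).2 hB₁
  -- measurability of the integrand
  have hGm : Measurable fun p : ℝ × 𝒢.automorphicQuotient =>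
      conj (Ψ p.2) * (Complex.exp (-((q : ℂ) * p.1 * Complex.I)) * Ψ ((t * (k p.1)⁻¹) • p.2)) := by
    refine (Complex.continuous_conj.measurable.comp (hΨm.comp measurable_snd)).mul (Measurable.mul ?_ (hΨm.comp hS))
    exact (Complex.continuous_exp.comp ((continuous_const.mul (Complex.continuous_ofReal.comp continuous_fst)).mul continuous_const).neg).measurable
  refine Integrable.mono' (hB₁.add hB₂) hGm.aestronglyMeasurable (Filter.Eventually.of_forall fun p => ?_)
  rw [Pi.add_apply, norm_mul, norm_mul, norm_cexp_neg_int_mul, one_mul, RCLike.norm_conj]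
  nlinarith [sq_nonneg (‖Ψ p.2‖ - ‖Ψ ((t * (k p.1)⁻¹) • p.2)‖), norm_nonneg (Ψ p.2), norm_nonneg (Ψ ((t * (k p.1)⁻¹) • p.2))]

end Product

/-! ## §3 The matrix coefficient -/

/-- `⟪R(t)ψ, ψ⟫ = ∫ conj Ψ(x)·Ψ(t•x) dμ` for `ψ = Ψ ∈ L²` (a.e. formula ★ `rightRegular_apply_coeFn`, invariance under `t`). [cite: Folland1995, §3.1] -/
theorem inner_rightRegular_toLp_eq_integral {Ψ : 𝒢.automorphicQuotient → ℂ} (hΨ2 : MemLp Ψ 2 μ) (t : 𝒢.Adelic) :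
    ⟪𝒢.rightRegular μ t (hΨ2.toLp Ψ), hΨ2.toLp Ψ⟫_ℂ = ∫ x, conj (Ψ x) * Ψ (t • x) ∂μ := by
  have hF : ∫ x, conj (Ψ x) * Ψ (t • x) ∂μ = ∫ x, conj (Ψ (t⁻¹ • x)) * Ψ x ∂μ := by
    rw [← integral_smul_eq_self (μ := μ) (fun x => conj (Ψ (t⁻¹ • x)) * Ψ x) (g := t)]
    exact integral_congr_ae (Filter.Eventually.of_forall fun x => by simp only [inv_smul_smul])
  rw [MeasureTheory.L2.inner_def, hF]
  refine integral_congr_ae ?_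
  have h1 := 𝒢.rightRegular_apply_coeFn μ t (hΨ2.toLp Ψ)
  have h2 : (fun x => (hΨ2.toLp Ψ : 𝒢.automorphicQuotient → ℂ) (t⁻¹ • x)) =ᵐ[μ] fun x => Ψ (t⁻¹ • x) :=
    (measurePreserving_smul t⁻¹ μ).quasiMeasurePreserving.ae_eq_comp hΨ2.coeFn_toLp
  filter_upwards [h1, h2, hΨ2.coeFn_toLp] with x hx1 hx2 hx3
  rw [RCLike.inner_apply', hx1, hx2, hx3]

omit [SMulInvariantMeasure 𝒢.Adelic 𝒢.automorphicQuotient μ] in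
/-- `‖ψ‖² = ∫ conj Ψ·Ψ dμ` for `ψ = Ψ ∈ L²`. [folklore] -/
theorem norm_sq_toLp_eq_integral {Ψ : 𝒢.automorphicQuotient → ℂ} (hΨ2 : MemLp Ψ 2 μ) :
    (((‖hΨ2.toLp Ψ‖ ^ 2 : ℝ)) : ℂ) = ∫ x, conj (Ψ x) * Ψ x ∂μ := by
  rw [show (((‖hΨ2.toLp Ψ‖ ^ 2 : ℝ)) : ℂ) = ⟪hΨ2.toLp Ψ, hΨ2.toLp Ψ⟫_ℂ by rw [inner_self_eq_norm_sq_to_K]; norm_cast, MeasureTheory.L2.inner_def]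
  refine integral_congr_ae ?_
  filter_upwards [hΨ2.coeFn_toLp] with x hx
  rw [RCLike.inner_apply', hx]

variable [IsFiniteMeasure μ]

/-- **THE AVERAGING TRICK: `⟪R(t)ψ, ψ⟫ = Φa·‖ψ‖²`** from the circle letters (KΨ) and (AV) — the `hmc` letter of ★ `arch_unitarity_of_rightRegular_matrixCoeff` at one torus element,
for every adelic group datum, every invariant finite measure, every measurable `Ψ ∈ L²`. [cite: Knapp1986, VII §1] [cite: Folland1995, §3.3] [cite: MoeglinWaldspurger1995, IV.3] -/
theorem inner_rightRegular_eq_of_circleAverage {Ψ : 𝒢.automorphicQuotient → ℂ} (hΨm : Measurable Ψ) (hΨ2 : MemLp Ψ 2 μ) (q : ℤ) (t : 𝒢.Adelic) (Φa : ℂ)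
    {k : ℝ → 𝒢.Adelic} (hk : Continuous k)
    (hKΨ : ∀ (x : 𝒢.automorphicQuotient) (θ : ℝ), Ψ ((k θ)⁻¹ • x) = Complex.exp ((q : ℂ) * θ * Complex.I) * Ψ x)
    (hAV : ∀ x : 𝒢.automorphicQuotient,
      ((2 * π)⁻¹ : ℝ) • ∫ θ in (0 : ℝ)..2 * π, Complex.exp (-((q : ℂ) * θ * Complex.I)) * Ψ ((t * (k θ)⁻¹) • x) = Φa * Ψ x) :
    ⟪𝒢.rightRegular μ t (hΨ2.toLp Ψ), hΨ2.toLp Ψ⟫_ℂ = Φa * (((‖hΨ2.toLp Ψ‖ ^ 2 : ℝ)) : ℂ) := by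
  rw [inner_rightRegular_toLp_eq_integral, norm_sq_toLp_eq_integral]
  set C : ℂ := ∫ x, conj (Ψ x) * Ψ (t • x) ∂μ with hC
  have h2π : (0 : ℝ) ≤ 2 * π := by positivity
  -- Fubini on `(0, 2π] × X`
  have hint := integrable_averagingIntegrand 𝒢 μ hΨm hΨ2 q t hk
  have hswap := integral_integral_swap (f := fun (θ : ℝ) (x : 𝒢.automorphicQuotient) =>
    conj (Ψ x) * (Complex.exp (-((q : ℂ) * θ * Complex.I)) * Ψ ((t * (k θ)⁻¹) • x))) hint
  -- the `θ`-first iterated integral is `2π · C`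
  have hL : (∫ θ in Ioc (0 : ℝ) (2 * π), ∫ x, conj (Ψ x) * (Complex.exp (-((q : ℂ) * θ * Complex.I)) * Ψ ((t * (k θ)⁻¹) • x)) ∂μ) = ((2 * π : ℝ) : ℂ) * C := by
    have hθ : ∀ θ : ℝ, (∫ x, conj (Ψ x) * (Complex.exp (-((q : ℂ) * θ * Complex.I)) * Ψ ((t * (k θ)⁻¹) • x)) ∂μ) = C := fun θ => by
      rw [hC, integral_conj_mul_translate_eq 𝒢 μ Ψ q t k hKΨ θ, ← integral_const_mul]
      exact integral_congr_ae (Filter.Eventually.of_forall fun x => by simp only; ring)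
    simp_rw [hθ]
    rw [setIntegral_const, Real.volume_real_Ioc_of_le h2π, sub_zero, Complex.real_smul]
  -- the `x`-first iterated integral is `2π · Φa · ∫ conj Ψ Ψ`
  have hR : (∫ x, (∫ θ in Ioc (0 : ℝ) (2 * π), conj (Ψ x) * (Complex.exp (-((q : ℂ) * θ * Complex.I)) * Ψ ((t * (k θ)⁻¹) • x))) ∂μ) =
      ((2 * π : ℝ) : ℂ) * Φa * ∫ x, conj (Ψ x) * Ψ x ∂μ := by
    rw [mul_assoc, ← integral_const_mul, ← integral_const_mul]
    refine integral_congr_ae (Filter.Eventually.of_forall fun x => ?_)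
    have hx := hAV x
    rw [intervalIntegral.integral_of_le h2π, Complex.real_smul] at hx
    have hx' : (∫ θ in Ioc (0 : ℝ) (2 * π), Complex.exp (-((q : ℂ) * θ * Complex.I)) * Ψ ((t * (k θ)⁻¹) • x)) = ((2 * π : ℝ) : ℂ) * (Φa * Ψ x) := by
      rw [← hx, ← mul_assoc, ← Complex.ofReal_mul, mul_inv_cancel₀ (by positivity : (2 * π : ℝ) ≠ 0), Complex.ofReal_one, one_mul]
    simp only
    rw [integral_const_mul, hx']
    ring
  rw [hL, hR] at hswap
  have h2π0 : ((2 * π : ℝ) : ℂ) ≠ 0 := Complex.ofReal_ne_zero.2 (by positivity)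
  rw [mul_assoc] at hswap
  exact mul_left_cancel₀ h2π0 hswap

end Summit.HodgeConjecture.HodgeConjecture.Cruxes.H413.K2E1ArchTorusMatrixCoeffFromCircleAverage

end
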